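import Literature.Computability.AlgebraicComplexity.ABV17SingPermFourPrelim
import HarnessLib

/-!
# Alper–Bogart–Velasco 2017, §1: `codim Sing(perm_4) ≥ 7` — the block chain at the standard pivot

Second file of the series (see `ABV17SingPermFourPrelim.lean` for the framing).  Throughout, `a` is a
`4 × 4` matrix over a domain `L ⊇ K` all of whose `3 × 3` subpermanents vanish (hypothesis `hvan`,
written out as the six-term expansion for every triple of distinct rows and columns), and the PIVOT
is the `2 × 2` permanent `g = a₀₀a₁₁ + a₀₁a₁₀ ≠ 0` on rows `{0,1}` × columns `{0,1}`; `BR` is the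
opposite block `{2,3} × {2,3}`, `BL = {2,3} × {0,1}`, `TR = {0,1} × {2,3}`.  Notation (in comments
only): `U_{cj} = per[01 | c j] = a₀c a₁ⱼ + a₀ⱼ a₁c`, `U'_{ri} = per[r i | 01]`,
`D = a₀₀a₀₁a₁₂a₁₃ + a₀₂a₀₃a₁₀a₁₁`, `D' = a₀₀a₁₀a₂₁a₃₁ + a₂₀a₃₀a₀₁a₁₁`,
`E_i = a_{i0} D + a_{i1} U₀₂U₀₃`, `E'_j = a_{0j} D' + a_{1j} U'₀₂U'₀₃`, `R1 = D² − U₀₂U₀₃U₁₂U₁₃`.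

Chains of kernels `Q_T = ker (f ↦ f(a^T))` (`a^T` = `a` with the coordinates in `T` freed):
* `block_chain` — the four `BR` coordinates are freed first (witness: the pivot minors
  `per[01i | 01j] = x_{ij} g + …`, as in the tree's `four_le_height_of_block`): `ht Q_BR + 4 ≤ ht Q_∅`;
* `seven_le_of_three_zeros` — three further vanishing coordinates outside `BR` give `7`;
* `eight_le_of_rows_zero` / `eight_le_of_cols_zero` — two zero rows or columns give `8`.
The chains for the cases `D ≠ 0` and "top of a right column vanishes" are in
`ABV17SingPermFourChains.lean`; the case analysis and the assembly follow.

Honest framing: dictionary work (von zur Gathen's problem at `k = 4`); VP ≠ VNP is NOT proved.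

## References
* J. Alper, T. Bogart, M. Velasco, Found. Comput. Math. 17 (2017), arXiv:1505.02205, §1 p0003 L38.
  [AlperBogartVelasco2017]
* J. von zur Gathen, Linear Algebra Appl. 96 (1987) 87–100, proof of Lemma 2.3 (the block freeing).
  [Vonzurgathen1987]
-/

noncomputable section

open Matrix MvPolynomial Finset

namespace Literature.Computability.AlgebraicComplexity

open VonZurGathen BoraleviCarliniMichalekVentura2025

namespace AlperBogartVelasco

variable {K : Type*} [Field K] {L : Type*} [CommRing L] [Algebra K L]

/-! ### Evaluation at partially freed points -/

section Eval

variable {σ : Type*} [DecidableEq σ]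

/-- At `a^T`, a freed coordinate evaluates to its indeterminate (BCMV's freed coordinates, proof of
Prop. 3.1). [cite: BoraleviCarliniMichalekVentura2025, proof of Prop. 3.1 (arXiv text p0006 L9–17)] -/
theorem aeval_piecewise_X_of_mem (a : σ → L) {T : Finset σ} {x : σ} (hx : x ∈ T) :
    aeval (T.piecewise X (C ∘ a) : σ → MvPolynomial σ L) (X x : MvPolynomial σ K) = X x := by
  rw [aeval_X, Finset.piecewise_eq_of_mem (hi := hx)]

/-- At `a^T`, an unfreed coordinate evaluates to the constant `a x` (BCMV's "outer dependence",
proof of Prop. 3.1). [cite: BoraleviCarliniMichalekVentura2025, proof of Prop. 3.1 (arXiv text p0006 L9–17)] -/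
theorem aeval_piecewise_X_of_notMem (a : σ → L) {T : Finset σ} {x : σ} (hx : x ∉ T) :
    aeval (T.piecewise X (C ∘ a) : σ → MvPolynomial σ L) (X x : MvPolynomial σ K) = C (a x) := by
  rw [aeval_X, Finset.piecewise_eq_of_notMem (hi := hx), Function.comp_apply]

end Eval

/-! ### The block `BR` and the pivot minors -/

section Pivot

variable (a : Fin 4 × Fin 4 → L)

/-- The pivot minor `per[{0,1,i} | {0,1,j}]` (`i, j ∈ {2,3}`) of `a`, as a subpermanent of the
`Matrix.of` of `a`, is the `hvan` expansion `a_{ij} g + a_{i0} U_{1j} + a_{i1} U_{0j}`.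
[cite: Vonzurgathen1987, proof of Lemma 2.3] -/
theorem subperm_insert_zero_one {i j : Fin 4} (hi0 : i ≠ 0) (hi1 : i ≠ 1) (hj0 : j ≠ 0)
    (hj1 : j ≠ 1) :
    (Matrix.of fun r c => a (r, c)).subperm (· ∈ insert j ({0, 1} : Finset (Fin 4)))
        (· ∈ insert i ({0, 1} : Finset (Fin 4))) =
      a (i, j) * (a (0, 0) * a (1, 1) + a (0, 1) * a (1, 0)) +
        a (i, 0) * (a (0, j) * a (1, 1) + a (0, 1) * a (1, j)) +
        a (i, 1) * (a (0, j) * a (1, 0) + a (0, 0) * a (1, j)) := by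
  rw [subperm_triple _ hi0 hi1 (by decide) hj0 hj1 (by decide)]
  simp only [Matrix.of_apply]

/-- The pivot `g = per[01 | 01]` as a subpermanent. [cite: Vonzurgathen1987, proof of Lemma 2.3] -/
theorem subperm_zero_one :
    (Matrix.of fun r c => a (r, c)).subperm (· ∈ ({0, 1} : Finset (Fin 4)))
        (· ∈ ({0, 1} : Finset (Fin 4))) = a (0, 0) * a (1, 1) + a (0, 1) * a (1, 0) := by
  rw [← rsubperm_eq_subperm, rsubperm_pair _ (by decide) (by decide)]
  simp only [Matrix.of_apply]

variable [IsDomain L]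

/-- **Freeing the block `BR`** (von zur Gathen's first four steps at the pivot `{0,1} × {0,1}`): if
the four pivot minors vanish at `a` and `g ≠ 0`, then `ht Q_BR + 4 ≤ ht (ker (f ↦ f(a)))` with
`BR = {(2,2),(2,3),(3,2),(3,3)}`. [cite: Vonzurgathen1987, proof of Lemma 2.3] -/
theorem block_chain
    (hg : a (0, 0) * a (1, 1) + a (0, 1) * a (1, 0) ≠ 0)
    (hP : ∀ i j : Fin 4, i ≠ 0 → i ≠ 1 → j ≠ 0 → j ≠ 1 →
      a (i, j) * (a (0, 0) * a (1, 1) + a (0, 1) * a (1, 0)) +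
        a (i, 0) * (a (0, j) * a (1, 1) + a (0, 1) * a (1, j)) +
        a (i, 1) * (a (0, j) * a (1, 0) + a (0, 0) * a (1, j)) = 0) :
    (RingHom.ker (aeval (R := K) ((({(2, 2), (2, 3), (3, 2), (3, 3)} : Finset (Fin 4 × Fin 4))).piecewise
        X (C ∘ a) : Fin 4 × Fin 4 → MvPolynomial (Fin 4 × Fin 4) L))).height + 4 ≤
      (RingHom.ker (aeval (R := K) a)).height := by
  set pt : Finset (Fin 4 × Fin 4) → Fin 4 × Fin 4 → MvPolynomial (Fin 4 × Fin 4) L :=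
    fun T => T.piecewise X (C ∘ a) with hpt
  have hRw : ∀ {i : Fin 4}, i ≠ 0 → i ≠ 1 → i ∉ ({0, 1} : Finset (Fin 4)) := by
    intro i h0 h1; simp [h0, h1]
  set T₁ : Finset (Fin 4 × Fin 4) := insert (2, 2) ∅ with hT₁
  set T₂ : Finset (Fin 4 × Fin 4) := insert (2, 3) T₁ with hT₂
  set T₃ : Finset (Fin 4 × Fin 4) := insert (3, 2) T₂ with hT₃
  set T₄ : Finset (Fin 4 × Fin 4) := insert (3, 3) T₃ with hT₄
  have hT₄eq : ({(2, 2), (2, 3), (3, 2), (3, 3)} : Finset (Fin 4 × Fin 4)) = T₄ := by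
    rw [hT₄, hT₃, hT₂, hT₁]; ext x; simp [or_comm, or_assoc]
  have hB : ∀ r c, (r, c) ∈ T₄ → (r = 2 ∨ r = 3) ∧ (c = 2 ∨ c = 3) := by
    intro r c hx
    simp only [hT₄, hT₃, hT₂, hT₁, Finset.mem_insert, Prod.mk.injEq, Finset.notMem_empty,
      or_false] at hx
    rcases hx with ⟨rfl, rfl⟩ | ⟨rfl, rfl⟩ | ⟨rfl, rfl⟩ | ⟨rfl, rfl⟩ <;> simp
  have hB₃ : ∀ r c, (r, c) ∈ T₃ → (r = 2 ∨ r = 3) ∧ (c = 2 ∨ c = 3) := fun r c hx =>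
    hB r c (Finset.mem_insert_of_mem hx)
  have hB₂ : ∀ r c, (r, c) ∈ T₂ → (r = 2 ∨ r = 3) ∧ (c = 2 ∨ c = 3) := fun r c hx =>
    hB₃ r c (Finset.mem_insert_of_mem hx)
  have hB₁ : ∀ r c, (r, c) ∈ T₁ → (r = 2 ∨ r = 3) ∧ (c = 2 ∨ c = 3) := fun r c hx =>
    hB₂ r c (Finset.mem_insert_of_mem hx)
  have step : ∀ (T : Finset (Fin 4 × Fin 4)) (i' j' : Fin 4), i' ≠ 0 → i' ≠ 1 → j' ≠ 0 → j' ≠ 1 →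
      (∀ r c, (r, c) ∈ insert (i', j') T → (r = 2 ∨ r = 3) ∧ (c = 2 ∨ c = 3)) →
      (i', j') ∉ T →
      (RingHom.ker (aeval (R := K) (pt (insert (i', j') T)))).height + 1 ≤
        (RingHom.ker (aeval (R := K) (pt T))).height := by
    intro T i' j' hi0 hi1 hj0 hj1 hBT hnot
    have h2R : (2 : Fin 4) ∉ ({0, 1} : Finset (Fin 4)) := by decide
    have h3R : (3 : Fin 4) ∉ ({0, 1} : Finset (Fin 4)) := by decide
    refine height_ker_aeval_piecewise_insert a T (i', j')
      ((mvPolynomialX (Fin 4) (Fin 4) K).subperm (· ∈ insert j' ({0, 1} : Finset (Fin 4)))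
        (· ∈ insert i' ({0, 1} : Finset (Fin 4)))) ?_ ?_
    · have hT' : ∀ x ∈ T, x.1 ∈ insert i' ({0, 1} : Finset (Fin 4)) →
          x.2 ∈ insert j' ({0, 1} : Finset (Fin 4)) → False :=
        fun x hx hr hc => hnot (blockOK h2R h3R h2R h3R
          (fun r c h => hBT r c (Finset.mem_insert_of_mem h)) i' j' x hx hr hc ▸ hx)
      rw [aeval_blockWitness_of_notMem a hT', subperm_insert_zero_one a hi0 hi1 hj0 hj1,
        hP i' j' hi0 hi1 hj0 hj1, map_zero]
    · rw [aeval_blockWitness_of_mem a (hRw hi0 hi1) (hRw hj0 hj1)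
        (blockOK h2R h3R h2R h3R hBT i' j') (Finset.mem_insert_self _ _), subperm_zero_one]
      exact X_mul_C_add_C_ne_zero hg
  have s₁ := step ∅ 2 2 (by decide) (by decide) (by decide) (by decide) hB₁ (Finset.notMem_empty _)
  have s₂ := step T₁ 2 3 (by decide) (by decide) (by decide) (by decide) hB₂ (by simp [hT₁])
  have s₃ := step T₂ 3 2 (by decide) (by decide) (by decide) (by decide) hB₃ (by simp [hT₂, hT₁])
  have s₄ := step T₃ 3 3 (by decide) (by decide) (by decide) (by decide) hB
    (by simp [hT₃, hT₂, hT₁])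
  rw [hT₄eq]
  have e0 : pt ∅ = ((∅ : Finset (Fin 4 × Fin 4)).piecewise X (C ∘ a)) := rfl
  calc (RingHom.ker (aeval (R := K) (pt T₄))).height + 4
      = (RingHom.ker (aeval (R := K) (pt T₄))).height + 1 + 1 + 1 + 1 := by
        rw [add_assoc, add_assoc, add_assoc]; norm_num
    _ ≤ (RingHom.ker (aeval (R := K) (pt T₃))).height + 1 + 1 + 1 := by
        gcongr
    _ ≤ (RingHom.ker (aeval (R := K) (pt T₂))).height + 1 + 1 := by gcongr
    _ ≤ (RingHom.ker (aeval (R := K) (pt T₁))).height + 1 := by gcongr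
    _ ≤ (RingHom.ker (aeval (R := K) (pt ∅))).height := s₁
    _ = (RingHom.ker (aeval (R := K) a)).height := by rw [e0, ker_aeval_piecewise_empty]

/-! ### Three late zeros, two zero rows / columns -/

/-- **Three vanishing coordinates outside `BR` finish the count**: `ht Q_BR + 4 ≤ ht Q_∅` and three
distinct zero coordinates of `a` outside `BR` give height `≥ 7` (free them after `BR`).
[cite: Vonzurgathen1987, proof of Lemma 2.3] -/
theorem seven_le_of_three_zeros
    (hg : a (0, 0) * a (1, 1) + a (0, 1) * a (1, 0) ≠ 0)
    (hP : ∀ i j : Fin 4, i ≠ 0 → i ≠ 1 → j ≠ 0 → j ≠ 1 →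
      a (i, j) * (a (0, 0) * a (1, 1) + a (0, 1) * a (1, 0)) +
        a (i, 0) * (a (0, j) * a (1, 1) + a (0, 1) * a (1, j)) +
        a (i, 1) * (a (0, j) * a (1, 0) + a (0, 0) * a (1, j)) = 0)
    (x y z : Fin 4 × Fin 4) (hxy : x ≠ y) (hxz : x ≠ z) (hyz : y ≠ z)
    (hx : x ∉ ({(2, 2), (2, 3), (3, 2), (3, 3)} : Finset (Fin 4 × Fin 4)))
    (hy : y ∉ ({(2, 2), (2, 3), (3, 2), (3, 3)} : Finset (Fin 4 × Fin 4)))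
    (hz : z ∉ ({(2, 2), (2, 3), (3, 2), (3, 3)} : Finset (Fin 4 × Fin 4)))
    (hax : a x = 0) (hay : a y = 0) (haz : a z = 0) :
    (7 : ℕ∞) ≤ (RingHom.ker (aeval (R := K) a)).height := by
  have hblock := block_chain (K := K) a hg hP
  set BR : Finset (Fin 4 × Fin 4) := {(2, 2), (2, 3), (3, 2), (3, 3)} with hBR
  have hS : ∀ w ∈ ({x, y, z} : Finset (Fin 4 × Fin 4)), a w = 0 := by
    intro w hw
    simp only [Finset.mem_insert, Finset.mem_singleton] at hw
    rcases hw with rfl | rfl | rfl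
    · exact hax
    · exact hay
    · exact haz
  have hdisj : Disjoint ({x, y, z} : Finset (Fin 4 × Fin 4)) BR := by
    rw [Finset.disjoint_left]
    intro w hw
    simp only [Finset.mem_insert, Finset.mem_singleton] at hw
    rcases hw with rfl | rfl | rfl
    · exact hx
    · exact hy
    · exact hz
  have hcard : ({x, y, z} : Finset (Fin 4 × Fin 4)).card = 3 := by
    rw [Finset.card_insert_of_notMem (by simp [hxy, hxz]), Finset.card_pair hyz]
  have h3 := height_ker_aeval_piecewise_union_add_card_le (K := K) a BR {x, y, z} hS hdisj
  rw [hcard] at h3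
  have h3' : (3 : ℕ∞) ≤ (RingHom.ker (aeval (R := K)
      (BR.piecewise X (C ∘ a) : Fin 4 × Fin 4 → MvPolynomial (Fin 4 × Fin 4) L))).height :=
    le_trans (by exact le_add_self) h3
  calc (7 : ℕ∞) = 3 + 4 := by norm_num
    _ ≤ _ := (add_le_add h3' le_rfl).trans hblock

/-- Two zero rows (`2` and `3`): eight vanishing coordinates, height `≥ 8`.
[cite: AlperBogartVelasco2017, Rem. 1.5] -/
theorem eight_le_of_rows_zero (h2 : ∀ j, a (2, j) = 0) (h3 : ∀ j, a (3, j) = 0) :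
    (8 : ℕ∞) ≤ (RingHom.ker (aeval (R := K) a)).height := by
  refine le_trans ?_ (card_le_height_ker_aeval (K := K) a
    ((({2, 3} : Finset (Fin 4)) ×ˢ (Finset.univ : Finset (Fin 4)))) ?_)
  · rw [Finset.card_product, Finset.card_pair (by decide), Finset.card_univ, Fintype.card_fin]
    norm_num
  · rintro ⟨r, c⟩ hx
    have hr : r ∈ ({2, 3} : Finset (Fin 4)) := (Finset.mem_product.1 hx).1
    simp only [Finset.mem_insert, Finset.mem_singleton] at hr
    rcases hr with rfl | rfl
    · exact h2 c
    · exact h3 c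

/-- Two zero columns (`2` and `3`): eight vanishing coordinates, height `≥ 8`.
[cite: AlperBogartVelasco2017, Rem. 1.5] -/
theorem eight_le_of_cols_zero (h2 : ∀ i, a (i, 2) = 0) (h3 : ∀ i, a (i, 3) = 0) :
    (8 : ℕ∞) ≤ (RingHom.ker (aeval (R := K) a)).height := by
  refine le_trans ?_ (card_le_height_ker_aeval (K := K) a
    (((Finset.univ : Finset (Fin 4)) ×ˢ ({2, 3} : Finset (Fin 4)))) ?_)
  · rw [Finset.card_product, Finset.card_pair (by decide), Finset.card_univ, Fintype.card_fin]
    norm_num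
  · rintro ⟨r, c⟩ hx
    have hc : c ∈ ({2, 3} : Finset (Fin 4)) := (Finset.mem_product.1 hx).2
    simp only [Finset.mem_insert, Finset.mem_singleton] at hc
    rcases hc with rfl | rfl
    · exact h2 r
    · exact h3 r

end Pivot

end AlperBogartVelasco

end Literature.Computability.AlgebraicComplexity

end
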